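import Summits.ABC.Analytic.PolySzpiro
import Literature.Barriers.ABC.SzpiroEpsilonCannotBeDroppedHolds
import Summits.ABC.ABC.Theorems.SoloBlindPolyABC
import Literature.NumberTheory.EllipticCurves.SzpiroSixFifthsProofs
import Literature.NumberTheory.DiophantineGeometry.AbcExponentBoundOfPolynomialBound
import Literature.NumberTheory.DiophantineGeometry.GenEllThm21With
import Literature.NumberTheory.DiophantineGeometry.AbcValuationProductFreyDataProofs
import Literature.NumberTheory.DiophantineGeometry.MinimalDiscriminantFactorizationProofs
import Literature.NumberTheory.EllipticCurves.IntegralModelMinimalScalingProofs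
import Literature.NumberTheory.EllipticCurves.DegreeConjectureAbcMurtyProofs
import Literature.NumberTheory.EllipticCurves.CongruenceNumberLevelBoundProofs
import Literature.NumberTheory.DiophantineGeometry.FaltingsHeightProofs
import Summits.ABC.ABC.Theorems.StewartYuHolds
import HarnessLib
import HarnessLib.Audit

/-!
# ABC — analytic / modular lens: GLUE for the degree parcel — rung A-PS in the abc-triple language (proof-only)

Cell `abc-an` (C1), seat `pr-2` (GLUE-DEG; plan `run/shared/lean/pub/abc-an/plan/{SPEC,TABLE}.md`, GLUE LEDGER edges
E20 / E20′ / E21♭ / E17). PROOF-ONLY: no definition, no `sorry`, no named-fact hypothesis unless it is in a signature.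
HONESTY: abc is not proved by any of this. **A-PS** (`Summit.ABC.PolySzpiroRat`, polynomial Szpiro over `ℚ`,
LADDER-ABC §1 rung A-PS, HUMAN D-0139/D-0140) is **NOT abc — «NOT abc — POLY-SZPIRO(E)»**; the weak abc conjecture
(«abc with SOME exponent») is NOT abc either. Typed ≠ proved: every conjecture below is used only as a hypothesis.

## §1 E20 — the kernel PLACEMENT of rung A-PS among the abc-type sentences (a SANDWICH, not an equivalence)

* `abc_le_rpow_of_polySzpiroRatEff` — **A-PS-eff `(K, C)` ⟹ `c ≤ 2^{(9+12K)/5} · e^{C/5} · rad(abc)^{K/5}` for every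
  abc triple** (EFFECTIVE, explicit). Proof = Oesterlé's remark (Sém. Bourbaki 694 (1988), §2 Remarque (Szpiro) p. 168,
  §3 p. 169: Szpiro ⟹ abc with exponent `6/5`) run with a free exponent: A-PS applied to the global minimal model `W₀`
  of the `2`-ISOGENOUS curve of the Frey–Hellegouarch curve (tree `exists_minimal_isog_model`: `N ∣ 2¹² rad(abc)`,
  `c⁵ ≤ 2⁹ |Δ(W₀)|`, `|Δ_min| = |Δ(W₀)|`), so `5 log c ≤ 9 log 2 + K (12 log 2 + log rad) + C`. The exponent `K/5`
  beats the `K/2` of the Frey curve itself (`(abc)² ≤ 2⁸ |Δ_min(E_{a,b})|`); at Szpiro's `K = 6 + ε` it is Oesterlé's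
  `6/5`, consistent with the PROVED `abc_sixFifths_of_szpiro_holds`. `K > 6` always (`six_lt_of_polySzpiroRatEff`,
  Masser 1990 via the PROVED barrier `SzpiroEpsilonCannotBeDropped_holds`), so `K/5 > 6/5`.
* `polyABC_of_polySzpiroRatEff : PolySzpiroRatEff K C → PolyABC (K/5)`, `abcWithExponent_of_polySzpiroRatEff :
  … → GenEll.ABCWithExponent (K/5)`, and **E20** `exists_abcWithExponent_of_polySzpiroRat :
  Summit.ABC.PolySzpiroRat → ∃ Λ > 0, GenEll.ABCWithExponent Λ` — rung A-PS implies the WEAK abc conjecture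
  «abc with some exponent» in the [GenEll] Thm 2.1 currency `ABCWithExponent Λ` (`GenEllThm21With.lean`).
* **E20′** `exists_abcWithExponent_iff_exists_abcExponentBound` — the same weak abc in Lagarias–Soundararajan's
  currency `∃ κ₁ > 0, ABCExponentBound κ₁` (XYZ paper §1 "abc conjecture, weak form"; tree bridge
  `abcWithExponent_iff_abcExponentBound_inv`, `κ₁ = 1/Λ`), and `exists_abcExponentBound_of_polySzpiroRat`.
  (`PolyABC K → ABCWithExponent K` is `abcWithExponent_of_polyABC`; with the abc-harv cell's
  `Summit.ABC.Harvest.pastenWeakABC_of_abcWithExponent` / `exists_polyABC_of_pastenWeakABC` Pasten's Conj. 1.2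
  `PastenWeakABC` is a fourth spelling of the same weak abc.)
* `polySzpiroRat_sandwich` — **`ABC ⟹ A-PS ⟹ weak abc`, and `ABC ↔ ABCWithExponent 1`** (tree `polySzpiroRat_of_abc`,
  `abcWithExponent_one_iff`). LADDER wording: «A-PS implies the weak abc conjecture of Lagarias–Soundararajan
  (∃ exponent; indeed exponent `K/5`); the converse weak-abc(Λ) ⟹ A-PS is known only for abc-exponents `Λ < 6/5`
  (Silverman AEC VIII.11.5(b): the `c₄³ − c₆² = 1728Δ` triple saturates at `6/5`), so A-PS is a priori STRONGER than
  weak abc and WEAKER than abc.» Presearch «weak abc implies Szpiro», «abc exponent Szpiro exponent» (corpus fts+vec,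
  galaxy): no converse in print beyond the `c₄³ − c₆²` argument.

§2 below: E17 / E17′ (R11 ENGINE comparison: Stewart–Yu in Szpiro currency on Frey curves vs the modular all-`E` bound, both
EXPONENTIAL in `log N`, neither A-PS). §3 (E21♭, the partial converse weak-abc(`Λ < 42/41`) ⟹ A-PS) is the companion file
`Summits/ABC/Analytic/GlueDegreeConverse.lean`.

References: [Oesterle1988] §2–§3; [SilvermanAEC2009] VIII.11.5(b), Ex. 8.21; [LagariasSoundararajan2011] §1;
[MochizukiGenEll2010] Thm 2.1; [Masser1990]; [PastenShimura2024] Conj. 1.1–1.2; [MurtyPasten2013] Thms 4.3, 7.1; [StewartYu2001] Thm 1.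
-/

noncomputable section

namespace Summit.ABC.Analytic

open Literature.NumberTheory.EllipticCurves Literature.NumberTheory.DiophantineGeometry WeierstrassCurve
open Summit.ABC

/-! ## §1 E20 — rung A-PS in the abc-triple language: A-PS-eff `(K, C)` ⟹ `c ≤ C' · rad(abc)^{K/5}` -/

/-- `log x ≤ K log y + B` with `x, y > 0` gives `x ≤ e^B · y^K` (the abc-an file I has this as
`Summit.ABC.Analytic.le_exp_mul_rpow_of_log_le`; restated privately because that module is not imported here). [folklore] -/
private theorem le_exp_mul_rpow_of_log_le' {x y K B : ℝ} (hx : 0 < x) (hy : 0 < y)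
    (h : Real.log x ≤ K * Real.log y + B) : x ≤ Real.exp B * y ^ K := by
  calc x = Real.exp (Real.log x) := (Real.exp_log hx).symm
    _ ≤ Real.exp (K * Real.log y + B) := Real.exp_le_exp.mpr h
    _ = Real.exp B * y ^ K := by
        rw [Real.exp_add, Real.rpow_def_of_pos hy, mul_comm (Real.log y) K, mul_comm]

/-- **Any A-PS exponent is `> 6`** (Masser 1990: `|Δ_min| ≤ C N⁶ (log N)^k` fails for all `C, k`; PROVED barrier
`Literature.Barriers.ABC.SzpiroEpsilonCannotBeDropped_holds`, here with `k = 0`). The abc-an file I proves the same floor for the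
unfolded sentence (`Summit.ABC.Analytic.not_polySzpiroLog_of_le_six`); this is its by-name form for `Summit.ABC.PolySzpiroRatEff`.
[cite: Masser1990, Theorem] -/
theorem six_lt_of_polySzpiroRatEff {K C : ℝ} (h : PolySzpiroRatEff K C) : 6 < K := by
  by_contra hK
  push Not at hK
  refine Literature.Barriers.ABC.SzpiroEpsilonCannotBeDropped_holds ⟨Real.exp C, 0, fun W _ => ?_⟩
  have hN : (0 : ℝ) < (W.conductorNorm ℤ : ℝ) := by exact_mod_cast conductorNorm_pos_holds W
  have hN1 : (1 : ℝ) ≤ (W.conductorNorm ℤ : ℝ) := by exact_mod_cast conductorNorm_pos_holds W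
  have hΔ : (0 : ℝ) < (W.minimalDiscriminantNorm ℤ : ℝ) := by
    exact_mod_cast minimalDiscriminantNorm_pos_holds W
  rw [Real.rpow_zero, mul_one]
  calc (W.minimalDiscriminantNorm ℤ : ℝ) ≤ Real.exp C * (W.conductorNorm ℤ : ℝ) ^ K :=
        le_exp_mul_rpow_of_log_le' hΔ hN (h W)
    _ ≤ Real.exp C * (W.conductorNorm ℤ : ℝ) ^ (6 : ℝ) :=
        mul_le_mul_of_nonneg_left (Real.rpow_le_rpow_of_exponent_le hN1 hK) (Real.exp_pos _).le
    _ = Real.exp C * (W.conductorNorm ℤ : ℝ) ^ 6 := by norm_cast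

/-- **E20-eff (Oesterlé's `2`-isogenous Frey model): A-PS-eff `(K, C)` ⟹ `c ≤ 2^{(9+12K)/5} · e^{C/5} · rad(abc)^{K/5}`
for every abc triple.** [cite: Oesterle1988, §2 Remarque (Szpiro), p. 168] -/
theorem abc_le_rpow_of_polySzpiroRatEff {K C : ℝ} (h : PolySzpiroRatEff K C)
    {a b c : ℕ} (habc : IsABCTriple a b c) :
    (c : ℝ) ≤ (2 : ℝ) ^ ((9 + 12 * K) / 5) * Real.exp (C / 5) * ((rad a b c : ℕ) : ℝ) ^ (K / 5) := by
  have hK : 0 ≤ K := by linarith [six_lt_of_polySzpiroRatEff h]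
  obtain ⟨W₀, hE, hmin, hN, hc5⟩ := exists_minimal_isog_model habc
  haveI := hE
  have key := h (W₀.baseChange ℚ)
  rw [minimalDiscriminantNorm_eq_natAbs_holds W₀ (Δ_ne_zero_of_isElliptic_baseChange_int W₀) hmin,
    Nat.cast_natAbs, Int.cast_abs] at key
  set N : ℝ := (((W₀.baseChange ℚ).conductorNorm ℤ : ℕ) : ℝ) with hNdef
  set R : ℝ := ((rad a b c : ℕ) : ℝ) with hRdef
  have hRpos : 0 < R := by
    rw [hRdef]; exact_mod_cast lt_of_lt_of_le two_pos habc.two_le_rad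
  have hNpos : 0 < N := by
    rw [hNdef]; exact_mod_cast conductorNorm_pos_holds (W₀.baseChange ℚ)
  -- `N ≤ 2¹² R`
  have hNle : N ≤ 2 ^ 12 * R := by
    have := Nat.le_of_dvd (mul_pos (by positivity)
      (by rw [rad_def]; exact Nat.radical_pos _)) hN
    rw [hNdef, hRdef]; exact_mod_cast this
  have hΔpos : 0 < |(W₀.Δ : ℝ)| := by
    have : (W₀.Δ : ℝ) ≠ 0 := by exact_mod_cast Δ_ne_zero_of_isElliptic_baseChange_int W₀
    exact abs_pos.mpr this
  have hc0 : (0 : ℝ) < c := by exact_mod_cast lt_of_lt_of_le two_pos habc.two_le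
  -- logarithms: `5 log c ≤ 9 log 2 + log|Δ| ≤ 9 log 2 + K log N + C ≤ 9 log 2 + K (12 log 2 + log R) + C`
  have h1 : 5 * Real.log c ≤ 9 * Real.log 2 + Real.log |(W₀.Δ : ℝ)| := by
    have hc5' : (c : ℝ) ^ 5 ≤ 2 ^ 9 * |(W₀.Δ : ℝ)| := by
      have : (c : ℝ) ^ 5 ≤ 512 * |(W₀.Δ : ℝ)| := by exact_mod_cast hc5
      linarith
    have := Real.log_le_log (by positivity) hc5'
    rwa [Real.log_pow, Real.log_mul (by positivity) hΔpos.ne', Real.log_pow] at this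
  have h2 : Real.log N ≤ 12 * Real.log 2 + Real.log R := by
    have := Real.log_le_log hNpos hNle
    rwa [Real.log_mul (by positivity) hRpos.ne', Real.log_pow] at this
  have h3 : Real.log (c : ℝ) ≤ (K / 5) * Real.log R + (((9 + 12 * K) / 5) * Real.log 2 + C / 5) := by
    nlinarith [mul_le_mul_of_nonneg_left h2 hK]
  calc (c : ℝ) ≤ Real.exp (((9 + 12 * K) / 5) * Real.log 2 + C / 5) * R ^ (K / 5) :=
        le_exp_mul_rpow_of_log_le' hc0 hRpos h3
    _ = (2 : ℝ) ^ ((9 + 12 * K) / 5) * Real.exp (C / 5) * R ^ (K / 5) := by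
        rw [Real.exp_add, Real.rpow_def_of_pos (by norm_num : (0 : ℝ) < 2), mul_comm (Real.log 2)]

/-- **E20 in `PolyABC` currency: A-PS-eff `(K, C)` ⟹ `PolyABC (K/5)`** (`c ≤ C' rad^{K/5}`, `C' = 2^{(9+12K)/5} e^{C/5}`).
[cite: Oesterle1988, §2 Remarque (Szpiro), p. 168] -/
theorem polyABC_of_polySzpiroRatEff {K C : ℝ} (h : PolySzpiroRatEff K C) :
    Summit.ABC.ABC.Theorems.PolyABC (K / 5) :=
  ⟨_, by positivity, fun _ _ _ habc => abc_le_rpow_of_polySzpiroRatEff h habc⟩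

/-- `PolyABC K` ⟹ abc with exponent `K` ([GenEll] `ABCWithExponent K`: `c < (C+1)·rad^{K(1+ε)}`, as `rad ≥ 1`, `K > 0`). [folklore] -/
theorem abcWithExponent_of_polyABC {K : ℝ} (h : Summit.ABC.ABC.Theorems.PolyABC K) :
    GenEll.ABCWithExponent K := by
  have hK := Summit.ABC.ABC.Theorems.polyABC_pos h
  obtain ⟨C, hC, hCK⟩ := h
  intro ε hε
  refine ⟨C + 1, by positivity, fun a b c habc => ?_⟩
  have hR1 : (1 : ℝ) ≤ ((rad a b c : ℕ) : ℝ) := by exact_mod_cast le_trans one_le_two habc.two_le_rad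
  have hpow : ((rad a b c : ℕ) : ℝ) ^ K ≤ ((rad a b c : ℕ) : ℝ) ^ (K * (1 + ε)) :=
    Real.rpow_le_rpow_of_exponent_le hR1 (by nlinarith)
  have hpos : 0 < ((rad a b c : ℕ) : ℝ) ^ (K * (1 + ε)) := Real.rpow_pos_of_pos (by linarith) _
  calc (c : ℝ) ≤ C * ((rad a b c : ℕ) : ℝ) ^ K := hCK a b c habc
    _ ≤ C * ((rad a b c : ℕ) : ℝ) ^ (K * (1 + ε)) := mul_le_mul_of_nonneg_left hpow hC.le
    _ < (C + 1) * ((rad a b c : ℕ) : ℝ) ^ (K * (1 + ε)) := by nlinarith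

/-- **E20-eff: A-PS-eff `(K, C)` ⟹ abc with exponent `K/5`** ([GenEll] `ABCWithExponent (K/5)`). [cite: Oesterle1988, §3, p. 169] -/
theorem abcWithExponent_of_polySzpiroRatEff {K C : ℝ} (h : PolySzpiroRatEff K C) :
    GenEll.ABCWithExponent (K / 5) :=
  abcWithExponent_of_polyABC (polyABC_of_polySzpiroRatEff h)

/-- **E20 (GLUE LEDGER): rung A-PS ⟹ the weak abc conjecture «abc with SOME exponent»**
(`Summit.ABC.PolySzpiroRat → ∃ Λ > 0, GenEll.ABCWithExponent Λ`; indeed `Λ = K/5 > 6/5`). [cite: Oesterle1988, §3, p. 169] -/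
theorem exists_abcWithExponent_of_polySzpiroRat (h : PolySzpiroRat) :
    ∃ Λ : ℝ, 0 < Λ ∧ GenEll.ABCWithExponent Λ := by
  obtain ⟨K, C, hKC⟩ := h
  exact ⟨K / 5, by linarith [six_lt_of_polySzpiroRatEff hKC], abcWithExponent_of_polySzpiroRatEff hKC⟩

/-- **E20′: «abc with some exponent» ([GenEll]/Mochizuki currency) ⟺ Lagarias–Soundararajan's weak abc `∃ κ₁ > 0, ABCExponentBound κ₁`**
(`κ₁ = 1/Λ`; tree `abcWithExponent_iff_abcExponentBound_inv`). [cite: LagariasSoundararajan2011, §1 (abc conjecture, weak form)] -/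
theorem exists_abcWithExponent_iff_exists_abcExponentBound :
    (∃ Λ : ℝ, 0 < Λ ∧ GenEll.ABCWithExponent Λ) ↔ ∃ κ₁ : ℝ, 0 < κ₁ ∧ ABCExponentBound κ₁ := by
  constructor
  · rintro ⟨Λ, hΛ, h⟩
    exact ⟨1 / Λ, by positivity, (abcWithExponent_iff_abcExponentBound_inv hΛ).mp h⟩
  · rintro ⟨κ, hκ, h⟩
    refine ⟨1 / κ, by positivity, (abcWithExponent_iff_abcExponentBound_inv (by positivity)).mpr ?_⟩
    rwa [one_div_one_div]

/-- **E20 in LS currency: rung A-PS ⟹ the weak abc conjecture of Lagarias–Soundararajan** (`∃ κ₁ > 0, ABCExponentBound κ₁`).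
[cite: LagariasSoundararajan2011, §1 (abc conjecture, weak form)] -/
theorem exists_abcExponentBound_of_polySzpiroRat (h : PolySzpiroRat) :
    ∃ κ₁ : ℝ, 0 < κ₁ ∧ ABCExponentBound κ₁ :=
  exists_abcWithExponent_iff_exists_abcExponentBound.mp (exists_abcWithExponent_of_polySzpiroRat h)

/-- **The kernel SANDWICH placing rung A-PS**: `ABC ⟹ A-PS ⟹ weak abc`, with `ABC ↔ ABCWithExponent 1`. [folklore] -/
theorem polySzpiroRat_sandwich :
    (_root_.ABC → PolySzpiroRat) ∧ (PolySzpiroRat → ∃ Λ : ℝ, 0 < Λ ∧ GenEll.ABCWithExponent Λ) ∧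
      (_root_.ABC ↔ GenEll.ABCWithExponent 1) :=
  ⟨polySzpiroRat_of_abc, exists_abcWithExponent_of_polySzpiroRat,
    (ABC_iff.trans GenEll.abcWithExponent_one_iff.symm)⟩

/-! ## §2 E17 — the ENGINE row R11: the two UNCONDITIONAL Szpiro-shape bounds, in one currency

All `E/ℚ` (modular method, tree theorems modulo the two NAMED printed facts modularity-with-integral-Manin-constant
`nonempty_modularParametrizationData` and Mazur–Kenku `PastenShimura2024_minimalDegree_le_163_mul`):
`exists_log_minimalDiscriminantNorm_lt_of_modularity_mazurKenku` (`∀ ε > 0`, `log|Δ_min(E)| < ε · N_E log N_E` for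
`N_E ≥ N₀(ε)`; Pasten 2024 Thm 7.5 sharpened in the tree), `pasten_thm_7_5_of_modularity_mazurKenku` (`(1/4+ε) N log N`),
and, modulo Murty–Pasten 2013 Thm 7.1 as a named fact, `MurtyPasten.log_minimalDiscriminant_lt_148_of_faltingsHeight_lt`
(`log|Δ_min(E)| < 1.2 · N_E log N_E + 148` for EVERY `E/ℚ`). Frey–Hellegouarch curves of abc triples (Baker's method,
UNCONDITIONAL, tree `Summit.ABC.ABC.Theorems.stewart_yu_holds`): the theorem below, `log|Δ_min(E_{a,b})| ≤
C · (N^{1/3} (log N)^3 + 1)`. COMPARISON (R11): on Frey curves Stewart–Yu's `N^{1/3+o(1)}` beats every modular `N^{1+o(1)}`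
polynomially IN `N`; both are EXPONENTIAL in `log N`; NEITHER is A-PS (`K log N + C`), and neither method has a printed path to a
polynomial bound (LADDER-ABC §1 rung A1 = Stewart–Yu in kernel; rung A-PS would supersede both). «NOT abc — and not A-PS either.» -/

/-- `|Δ_min(W₀ ⊗ ℚ)| ≤ |Δ(W₀)|` for an integral Weierstrass equation `W₀/ℤ` of an elliptic curve: prime by prime
`ord_p(Δ_min) ≤ v_p(Δ(W₀))` (tree `exists_ordMinimalDiscriminant_add_eq_padicValInt`, Silverman AEC VII.1 Remark 1.1) and
`|Δ_min| = ∏ p^{ord_p}` (`factorization_minimalDiscriminantNorm_holds`). (The route file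
`Summits/ABC/ABC/Theorems/DefiniteXiXiBoundSzpiroBootstrap.lean` has the same lemma inside a route cone; restated privately.)
[cite: SilvermanAEC2009, VII.1 Remark 1.1] -/
private theorem minimalDiscriminantNorm_le_natAbs_Δ' (W₀ : WeierstrassCurve ℤ) [(W₀.baseChange ℚ).IsElliptic] :
    (W₀.baseChange ℚ).minimalDiscriminantNorm ℤ ≤ W₀.Δ.natAbs := by
  have hΔ0 : W₀.Δ ≠ 0 := Δ_ne_zero_of_isElliptic_baseChange_int W₀
  have hD0 : (W₀.baseChange ℚ).minimalDiscriminantNorm ℤ ≠ 0 := (minimalDiscriminantNorm_pos_holds _).ne'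
  refine Nat.le_of_dvd (Int.natAbs_pos.mpr hΔ0) ?_
  rw [← Nat.factorization_le_iff_dvd hD0 (Int.natAbs_ne_zero.mpr hΔ0)]
  intro p
  by_cases hp : p.Prime
  · obtain ⟨v, hv⟩ := exists_place ⟨p, hp⟩
    have hfac := factorization_minimalDiscriminantNorm_holds (W₀.baseChange ℚ) v
    obtain ⟨k, hk, -, -⟩ := exists_ordMinimalDiscriminant_add_eq_padicValInt v W₀
    haveI : Fact (Rat.HeightOneSpectrum.natGenerator v).Prime := ⟨Rat.HeightOneSpectrum.prime_natGenerator v⟩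
    have hval : padicValInt (Rat.HeightOneSpectrum.natGenerator v) W₀.Δ =
        W₀.Δ.natAbs.factorization (Rat.HeightOneSpectrum.natGenerator v) := by
      rw [padicValInt, Nat.factorization_def _ (Rat.HeightOneSpectrum.prime_natGenerator v)]
    simp only at hv
    rw [← hv, hfac, ← hval]
    omega
  · simp [Nat.factorization_eq_zero_of_not_prime _ hp]

/-- **`|Δ_min(E_{a,b})| ≤ 16 (abc)²`** for the Frey–Hellegouarch curve of an abc triple (the integral model
`y² = x³ + (b − a)x² − ab x` has `Δ = 16 (ab(a+b))²`, tree `freyIntModel_Δ`). [cite: BombieriGubler2006, Ex. 12.5.10] -/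
theorem minimalDiscriminantNorm_freyCurve_le_of_isABCTriple {a b c : ℕ} (h : IsABCTriple a b c) :
    (freyCurve (a : ℤ) (b : ℤ)).minimalDiscriminantNorm ℤ ≤ 16 * (a * b * c) ^ 2 := by
  haveI := isElliptic_freyIntModel h.int_prod_ne_zero
  have h1 := minimalDiscriminantNorm_le_natAbs_Δ' (freyIntModel (a : ℤ) (b : ℤ))
  rw [baseChange_freyIntModel, freyIntModel_Δ, Int.natAbs_mul, Int.natAbs_pow, h.natAbs_int_prod] at h1
  exact h1

/-- **`rad(abc) ≤ 2 · N(E_{a,b})`** for the Frey–Hellegouarch curve of an abc triple (odd primes of `abc` are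
multiplicative, tree `radical_natAbs_dvd_two_mul_conductorNorm_freyCurve`). [cite: BombieriGubler2006, Ex. 12.5.10] -/
theorem rad_le_two_mul_conductorNorm_freyCurve {a b c : ℕ} (h : IsABCTriple a b c) :
    rad a b c ≤ 2 * (freyCurve (a : ℤ) (b : ℤ)).conductorNorm ℤ := by
  have hab : IsCoprime (a : ℤ) (b : ℤ) := Nat.isCoprime_iff_coprime.mpr h.2.2.2
  have hd := radical_natAbs_dvd_two_mul_conductorNorm_freyCurve hab h.int_prod_ne_zero
  rw [h.natAbs_int_prod, ← rad_def] at hd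
  haveI := h.freyCurve_isElliptic
  have hN := conductorNorm_pos_holds (freyCurve (a : ℤ) (b : ℤ))
  exact Nat.le_of_dvd (by omega) hd

/-- **E17 (R11, Baker side): Stewart–Yu 2001 Thm 1 in Szpiro currency on the Frey–Hellegouarch curves — UNCONDITIONAL.**
There is `C` with `log|Δ_min(E_{a,b})| ≤ C · (N^{1/3} (log N)^3 + 1)` (`N = N(E_{a,b})`) for every abc triple `(a, b, c)`:
`|Δ_min| ≤ 16 (abc)² ≤ 16 c⁶`, `log c ≤ C₀ rad^{1/3} (log rad)^3` (tree `stewart_yu_holds`), `rad ≤ 2N`; the `+1` absorbs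
`N = 1`-type degenerations (`rad = 2`). This is `exp`-scale `N^{1/3+o(1)}` against the modular method's `N^{1+o(1)}` for ALL
`E/ℚ` (`exists_log_minimalDiscriminantNorm_lt_of_modularity_mazurKenku`, mod modularity + Mazur–Kenku): both EXPONENTIAL in
`log N`, neither is A-PS, neither is abc. [cite: StewartYu2001, Theorem 1] -/
theorem exists_log_minimalDiscriminantNorm_freyCurve_le_stewartYu :
    ∃ C : ℝ, ∀ a b c : ℕ, IsABCTriple a b c →
      Real.log ((freyCurve (a : ℤ) (b : ℤ)).minimalDiscriminantNorm ℤ : ℝ) ≤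
        C * ((((freyCurve (a : ℤ) (b : ℤ)).conductorNorm ℤ : ℕ) : ℝ) ^ (1 / 3 : ℝ) *
          Real.log (((freyCurve (a : ℤ) (b : ℤ)).conductorNorm ℤ : ℕ) : ℝ) ^ 3 + 1) := by
  obtain ⟨C₀, hC₀⟩ := Summit.ABC.ABC.Theorems.stewart_yu_holds
  set C₁ : ℝ := max C₀ 0 with hC₁
  have hC₁0 : 0 ≤ C₁ := le_max_right _ _
  refine ⟨Real.log 16 + 96 * C₁, fun a b c h => ?_⟩
  set E : WeierstrassCurve ℚ := freyCurve (a : ℤ) (b : ℤ) with hE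
  haveI := h.freyCurve_isElliptic
  set N : ℝ := ((E.conductorNorm ℤ : ℕ) : ℝ) with hNdef
  set R : ℝ := ((rad a b c : ℕ) : ℝ) with hRdef
  have hNnat : 1 ≤ E.conductorNorm ℤ := E.conductorNorm_pos_holds
  have hN1 : (1 : ℝ) ≤ N := by rw [hNdef]; exact_mod_cast hNnat
  have hR2 : (2 : ℝ) ≤ R := by rw [hRdef]; exact_mod_cast h.two_le_rad
  have hR0 : (0 : ℝ) < R := by linarith
  have hlogR0 : 0 ≤ Real.log R := Real.log_nonneg (by linarith)
  have hlogN0 : 0 ≤ Real.log N := Real.log_nonneg hN1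
  have hRN : R ≤ 2 * N := by
    rw [hRdef, hNdef]; exact_mod_cast rad_le_two_mul_conductorNorm_freyCurve h
  -- `log Δ_min ≤ log 16 + 6 log c`
  have hΔpos : (0 : ℝ) < (E.minimalDiscriminantNorm ℤ : ℝ) := by
    exact_mod_cast E.minimalDiscriminantNorm_pos_holds
  have hc2 : (2 : ℝ) ≤ c := by exact_mod_cast h.two_le
  have hΔle : (E.minimalDiscriminantNorm ℤ : ℝ) ≤ 16 * (c : ℝ) ^ 6 := by
    have h1 : ((E.minimalDiscriminantNorm ℤ : ℕ) : ℝ) ≤ ((16 * (a * b * c) ^ 2 : ℕ) : ℝ) := by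
      exact_mod_cast minimalDiscriminantNorm_freyCurve_le_of_isABCTriple h
    have h2 : ((a * b * c : ℕ) : ℝ) ≤ (c : ℝ) ^ 3 := by
      obtain ⟨ha, hb, habc, -⟩ := h
      exact_mod_cast (show a * b * c ≤ c ^ 3 by
        calc a * b * c ≤ c * c * c := by gcongr <;> omega
          _ = c ^ 3 := by ring)
    push_cast at h1 h2
    have h3 : ((a : ℝ) * b * c) ^ 2 ≤ ((c : ℝ) ^ 3) ^ 2 := pow_le_pow_left₀ (by positivity) h2 2
    nlinarith [h1, h3]
  have hlogΔ : Real.log (E.minimalDiscriminantNorm ℤ : ℝ) ≤ Real.log 16 + 6 * Real.log c := by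
    have := Real.log_le_log hΔpos hΔle
    rwa [Real.log_mul (by norm_num) (by positivity), Real.log_pow] at this
  -- Stewart–Yu: `log c ≤ C₁ R^{1/3} (log R)^3`
  have hSY : Real.log c ≤ C₁ * R ^ (1 / 3 : ℝ) * Real.log R ^ 3 := by
    have h1 := hC₀ a b c h
    have hnn : 0 ≤ R ^ (1 / 3 : ℝ) * Real.log R ^ 3 := by positivity
    calc Real.log c ≤ C₀ * R ^ (1 / 3 : ℝ) * Real.log R ^ 3 := h1
      _ ≤ C₁ * R ^ (1 / 3 : ℝ) * Real.log R ^ 3 := by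
          rw [mul_assoc, mul_assoc]; exact mul_le_mul_of_nonneg_right (le_max_left _ _) hnn
  -- `R^{1/3} ≤ 2 N^{1/3}` and either `N = 1` (then `R = 2`) or `log R ≤ 2 log N`
  have hR13 : R ^ (1 / 3 : ℝ) ≤ 2 * N ^ (1 / 3 : ℝ) := by
    calc R ^ (1 / 3 : ℝ) ≤ (2 * N) ^ (1 / 3 : ℝ) := Real.rpow_le_rpow hR0.le hRN (by norm_num)
      _ = (2 : ℝ) ^ (1 / 3 : ℝ) * N ^ (1 / 3 : ℝ) := Real.mul_rpow (by norm_num) (by linarith)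
      _ ≤ 2 * N ^ (1 / 3 : ℝ) := by
          refine mul_le_mul_of_nonneg_right ?_ (by positivity)
          calc (2 : ℝ) ^ (1 / 3 : ℝ) ≤ (2 : ℝ) ^ (1 : ℝ) :=
                Real.rpow_le_rpow_of_exponent_le (by norm_num) (by norm_num)
            _ = 2 := Real.rpow_one 2
  have hN13 : 0 ≤ N ^ (1 / 3 : ℝ) := by positivity
  have hlog2 : Real.log 2 ≤ 1 := by
    have := Real.log_two_lt_d9; norm_num at this; linarith
  have hlog2pos : 0 < Real.log 2 := Real.log_pos one_lt_two
  set X : ℝ := N ^ (1 / 3 : ℝ) * Real.log N ^ 3 with hX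
  have hX0 : 0 ≤ X := by positivity
  have hlog16 : 0 ≤ Real.log 16 := Real.log_nonneg (by norm_num)
  by_cases hN2 : (2 : ℝ) ≤ N
  · -- `log R ≤ log 2 + log N ≤ 2 log N`
    have hlogR : Real.log R ≤ 2 * Real.log N := by
      have h1 := Real.log_le_log hR0 hRN
      rw [Real.log_mul (by norm_num) (by linarith)] at h1
      have h2 : Real.log 2 ≤ Real.log N := Real.log_le_log two_pos hN2
      linarith
    have hlogR3 : Real.log R ^ 3 ≤ 8 * Real.log N ^ 3 := by
      calc Real.log R ^ 3 ≤ (2 * Real.log N) ^ 3 := pow_le_pow_left₀ hlogR0 hlogR 3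
        _ = 8 * Real.log N ^ 3 := by ring
    have hmain : C₁ * R ^ (1 / 3 : ℝ) * Real.log R ^ 3 ≤ 16 * C₁ * X := by
      calc C₁ * R ^ (1 / 3 : ℝ) * Real.log R ^ 3 ≤ C₁ * (2 * N ^ (1 / 3 : ℝ)) * (8 * Real.log N ^ 3) := by
            gcongr
        _ = 16 * C₁ * X := by rw [hX]; ring
    calc Real.log (E.minimalDiscriminantNorm ℤ : ℝ) ≤ Real.log 16 + 6 * (16 * C₁ * X) := by
          linarith [hlogΔ, hSY, hmain]
      _ = Real.log 16 + 96 * C₁ * X := by ring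
      _ ≤ (Real.log 16 + 96 * C₁) * (X + 1) := by nlinarith
  · -- `N < 2`, so `2 ≤ R ≤ 2N < 4`: `R^{1/3} ≤ 8^{1/3} = 2`, `log R ≤ 2 log 2 < 1.39`
    push Not at hN2
    have hRle4 : R ≤ 4 := by linarith
    have hRle8 : R ≤ 8 := by linarith
    have hR13' : R ^ (1 / 3 : ℝ) ≤ 2 := by
      calc R ^ (1 / 3 : ℝ) ≤ (8 : ℝ) ^ (1 / 3 : ℝ) := Real.rpow_le_rpow hR0.le hRle8 (by norm_num)
        _ = 2 := by
            rw [show (8 : ℝ) = (2 : ℝ) ^ ((3 : ℕ) : ℝ) by norm_num, ← Real.rpow_mul (by norm_num)]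
            norm_num
    have hlogR : Real.log R ≤ 1.39 := by
      have h4 : Real.log R ≤ 2 * Real.log 2 := by
        calc Real.log R ≤ Real.log 4 := Real.log_le_log hR0 hRle4
          _ = 2 * Real.log 2 := by
              rw [show (4 : ℝ) = 2 ^ 2 by norm_num, Real.log_pow]; norm_num
      have := Real.log_two_lt_d9
      linarith
    have h3 : Real.log R ^ 3 ≤ (1.39 : ℝ) ^ 3 := pow_le_pow_left₀ hlogR0 hlogR 3
    have hmain : C₁ * R ^ (1 / 3 : ℝ) * Real.log R ^ 3 ≤ C₁ * 2 * (1.39 : ℝ) ^ 3 := by gcongr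
    calc Real.log (E.minimalDiscriminantNorm ℤ : ℝ) ≤ Real.log 16 + 6 * (C₁ * 2 * (1.39 : ℝ) ^ 3) := by
          linarith [hlogΔ, hSY, hmain]
      _ ≤ Real.log 16 + 96 * C₁ := by nlinarith
      _ ≤ (Real.log 16 + 96 * C₁) * (X + 1) := by nlinarith

/-- **E17′ (R11, modular side — ALL `E/ℚ`, explicit constants, ONE line): the modular method's Szpiro-shape bound**
modulo exactly three NAMED printed theorems — modularity with an integral Manin constant (`nonempty_modularParametrizationData`,
Wiles–BCDT + Edixhoven), Mazur–Kenku (`PastenShimura2024_minimalDegree_le_163_mul`) and Murty–Pasten 2013 Thm 4.3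
`log m_f ≤ (1/5) N log N` (`MurtyPasten.log_modularDegree_le`, the best UNCONDITIONAL modular-degree upper bound in print for all
`N`; Pasten 2024 Thm 7.2 improves the constant asymptotically): **`log|Δ_min(E)| < 1.2 · N_E log N_E + 148` for EVERY elliptic
`E/ℚ`** (tree: MP Thm 7.1 height clause `MurtyPasten.faltingsHeight_lt_of_modularity_of_log_modularDegree_le`, then the PROVED
`log|Δ_min| < 12 h_F + 16`, `MurtyPasten.log_minimalDiscriminant_lt_148_of_faltingsHeight_lt`). ENGINE verdict (R11): the input is
`exp`-scale `N^{1.2 N}`-type, i.e. EXPONENTIAL in `log N`; A-PS needs `K log N + C`. «NOT abc — and not A-PS either.»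
[cite: MurtyPasten2013, Thm 4.3 (p. 3748) and Thm 7.1 (p. 3751–3752)] [cite: PastenShimura2024, §3 p. 13] -/
theorem log_minimalDiscriminantNorm_lt_of_modularity_mazurKenku_thm43
    (hmod : ModularForms.nonempty_modularParametrizationData)
    (h163 : ModularForms.PastenShimura2024_minimalDegree_le_163_mul)
    (h43 : MurtyPasten.log_modularDegree_le) (W : WeierstrassCurve ℚ) [W.IsElliptic] :
    Real.log (W.minimalDiscriminantNorm ℤ) <
      1.2 * (W.conductorNorm ℤ : ℝ) * Real.log (W.conductorNorm ℤ) + 148 :=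
  MurtyPasten.log_minimalDiscriminant_lt_148_of_faltingsHeight_lt
    (MurtyPasten.faltingsHeight_lt_of_modularity_of_log_modularDegree_le hmod h163 h43)
    WeierstrassCurve.log_minimalDiscriminantNorm_lt_faltingsHeight_holds W

end Summit.ABC.Analytic

end
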